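/-
COR-CM (cell pub-hodgecm2, stage 2 of the Hodge ladder) — junction B01 `PerLFace_of_PerL`: the displayed leaf B01-S `Universe.FaceSupply`
RE-TYPED at the level of MORPHISMS («isotypicity is free»): `FaceSupply ↔ FaceAlbaneseReach` over the model rows `Fact_H1_rank`,
`Fact_eigenLine`, `Fact_alphaLine` (tree theorems on the model universe).  STATEMENTS AND PROOFS AUTHORED by the ideation seat
planner-pub-hodgecm2-b01-idea-1-g4-0 (`HOME/b01/IDEA-1d-Sketch.lean`, md5 b44954053ed6, §1 + §4; farm rc 0 · 0 sorry, 2026-08-21T07:44Z);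
FILED (this header; §2 `CMReach` and §3 typed classes of the sketch NOT included — recorded in ROUTES-B01.md only) by the single owner of
B01, prover-pub-hodgecm2-own-b01-0.  One plain `def … : Prop` PROVED here (`Universe.EigenSupport`), one `@[conjecture] def`
(`Universe.FaceAlbaneseReach`, an EQUIVALENT form of B01-S on the model universe — not a new leaf), theorems; nothing cited as a record,
nothing asserted.
-/
import Summits.HodgeConjecture.CorCM.B01.FaceInputsSplit
import Summits.HodgeConjecture.CorCM.Model.ModelAxiomsHolds
import HarnessLib

noncomputable section

open scoped TensorProduct

namespace Summit.HodgeConjecture.CorCM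

open Literature.AlgebraicGeometry.Motives (CMType HodgeStructure)
open Literature.AlgebraicGeometry.Motives.HodgeStructure (EndAction conj)

namespace Universe

variable (U : Universe)

/-! ## §1  L1-K — eigenvector support: `U_Ψ(Γ) ≠ 0` iff some morphism `P_Γ → A_{(K,Ψ)}` is non-zero on `H¹` -/

/-- **EigenSupport** (pure linear algebra; PROVED below from `Fact_H1_rank`: `eigenSupport_of_H1_rank`).  A non-zero simultaneous `σ`-eigenvector
`α ∈ H¹(A_{(K,Ψ)}, ℂ)_σ` is killed by the complexification of a `ℚ`-linear map `φ = F^*` only if `φ = 0`.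
Reason: `H¹(A, ℚ)` is a one-dimensional `K`-vector space (`Fact_H1_rank` + `ι : K →ₐ[ℚ] End`), so the `ℚ`-support of
`α` (the least `ℚ`-subspace `S ≤ H¹(A,ℚ)` with `α ∈ ℂ ⊗ S`) is `K`-stable and non-zero, hence everything; and
`φ_ℂ α = 0 ⟹ α ∈ ℂ ⊗ ker φ ⟹ ker φ = ⊤`.  Equivalently, in trace-dual bases `α = Σ_j σ(g_j) ⊗ f_j` has
`ℚ`-linearly independent coordinates. [folklore] -/
def EigenSupport : Prop :=
  ∀ (K : CMField) (Ψ : CMType K) (σ : K →+* ℂ) (α : U.CohC (U.cmAV K Ψ) 1),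
    α ∈ U.eigenLine K Ψ σ → α ≠ 0 →
      ∀ (X : U.Var) (F : U.Mor X (U.cmAV K Ψ)), U.pullC F 1 α = 0 → U.pull F 1 = 0

/-- **FaceAlbaneseReach** (B01-S re-typed at the level of MORPHISMS; the `hΘ`/isotypicity kind disappears): for every
face datum `(F, f, ι₁, V)` some level `Γ` carries morphisms `F₀ : P_Γ → A_{(F,Ψ₀)}`, `F₁ : P_Γ → A_{(F,Ψ₁)}` that are
non-zero on `H¹(−, ℚ)` (in the model: the CM isogeny factors of `Alb(P_Γ)` of the two slot types; memo §2 L1-L).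
Displayed hypothesis; not asserted. -/
@[conjecture]
def FaceAlbaneseReach : Prop :=
  ∀ (F : CMField), IsGalois ℚ F → 6 ≤ Module.finrank ℚ F →
    ∀ (f : Face F) (ι₁ : F →+* ℂ), f.Admissible ι₁ →
    ∀ V : HermSpace3 F ι₁, ∃ (Γ : Level V)
      (F₀ : U.Mor (U.pms F ι₁ V Γ) (U.cmAV F (f.psi 0))) (F₁ : U.Mor (U.pms F ι₁ V Γ) (U.cmAV F (f.psi 1))),
      U.pull F₀ 1 ≠ 0 ∧ U.pull F₁ 1 ≠ 0

variable {U}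

/-! ### Proof of `EigenSupport` from `Fact_H1_rank` (pure linear algebra) -/

/-- The functionals `μ ⊗ 1`, `μ ∈ V^∨`, separate the points of `ℂ ⊗_ℚ V`. -/
private theorem eq_zero_of_forall_dual_baseChange {V : Type} [AddCommGroup V] [Module ℚ V] [Module.Finite ℚ V]
    (α : ℂ ⊗[ℚ] V) (h : ∀ μ : Module.Dual ℚ V, (LinearMap.baseChange ℂ μ) α = 0) : α = 0 := by
  classical
  let b := Module.finBasis ℚ V
  let B := Algebra.TensorProduct.basis ℂ b
  have hrepr : ∀ i, B.repr α i = 0 := by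
    intro i
    let f : ℂ ⊗[ℚ] V →ₗ[ℚ] ℂ := ((Finsupp.lapply i) ∘ₗ (B.repr : ℂ ⊗[ℚ] V →ₗ[ℂ] _)).restrictScalars ℚ
    let g : ℂ ⊗[ℚ] V →ₗ[ℚ] ℂ :=
      (TensorProduct.rid ℚ ℂ).toLinearMap ∘ₗ ((b.coord i).baseChange ℂ).restrictScalars ℚ
    have hfg : f = g := by
      apply TensorProduct.ext'
      intro c v
      simp [f, g, B, Algebra.TensorProduct.basis_repr_tmul, LinearMap.baseChange_tmul, TensorProduct.rid_tmul,
        Algebra.smul_def, mul_comm]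
    have hf : f α = B.repr α i := rfl
    have hg : g α = 0 := by
      simp only [g, LinearMap.comp_apply, LinearMap.restrictScalars_apply, LinearEquiv.coe_coe]
      rw [h, map_zero]
    rw [← hf, hfg, hg]
  exact (LinearEquiv.map_eq_zero_iff B.repr).1 (Finsupp.ext hrepr)

/-- **`EigenSupport` is a theorem of every universe with `Fact_H1_rank`** (`dim_ℚ H¹(A_{(K,Ψ)}, ℚ) = [K:ℚ]`).
Proof: the rational functionals `μ` with `(μ ⊗ 1)α = 0` form a `ℚ`-subspace `N ≤ H¹(A,ℚ)^∨` stable under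
`μ ↦ μ ∘ ι(e)` (`α` is a simultaneous eigenvector); if `N ∋ μ₀ ≠ 0` the orbit map `e ↦ μ₀ ∘ ι(e)` is an injection
`K ↪ N` (`K` is a field), so `dim N ≥ [K:ℚ] = dim H¹(A,ℚ)^∨` and `N = ⊤`, forcing `α = 0`; hence `N = ⊥`, and every
`μ' ∘ F^*` lies in `N`, so `F^* = 0`. -/
theorem eigenSupport_of_H1_rank (hH : U.Fact_H1_rank) : U.EigenSupport := by
  intro K Ψ σ α hα hα0 X F hF
  classical
  -- the annihilator of `α` among rational functionals on `V = H¹(A_{(K,Ψ)}, ℚ)`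
  let N : Submodule ℚ (Module.Dual ℚ (U.Coh (U.cmAV K Ψ) 1)) :=
    { carrier := {μ | (LinearMap.baseChange ℂ μ) α = 0}
      add_mem' := by
        intro μ ν hμ hν
        simp only [Set.mem_setOf_eq] at hμ hν ⊢
        rw [LinearMap.baseChange_add, LinearMap.add_apply, hμ, hν, add_zero]
      zero_mem' := by simp
      smul_mem' := by
        intro r μ hμ
        simp only [Set.mem_setOf_eq] at hμ ⊢
        rw [LinearMap.baseChange_smul, LinearMap.smul_apply, hμ, smul_zero] }
  have hmemN : ∀ μ, μ ∈ N ↔ (LinearMap.baseChange ℂ μ) α = 0 := fun μ => Iff.rfl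
  -- `α` is a simultaneous `σ`-eigenvector
  have heig : ∀ e : K, (((U.cmAct K Ψ).ι e).baseChange ℂ) α = (σ e) • α := by
    intro e
    have hα' := hα
    rw [Universe.eigenLine, Submodule.mem_iInf] at hα'
    exact Module.End.mem_eigenspace_iff.1 (hα' e)
  -- `N` is stable under `μ ↦ μ ∘ ι e`
  have hstab : ∀ μ ∈ N, ∀ e : K, μ ∘ₗ ((U.cmAct K Ψ).ι e : Module.End ℚ _) ∈ N := by
    intro μ hμ e
    rw [hmemN] at hμ ⊢
    rw [LinearMap.baseChange_comp, LinearMap.comp_apply, heig, map_smul, hμ, smul_zero]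
  have hdual : Module.finrank ℚ (Module.Dual ℚ (U.Coh (U.cmAV K Ψ) 1)) = Module.finrank ℚ K := by
    rw [Subspace.dual_finrank_eq]; exact hH K Ψ
  -- dichotomy `N = ⊥ ∨ N = ⊤`
  have hN : N = ⊥ ∨ N = ⊤ := by
    by_cases hbot : N = ⊥
    · exact Or.inl hbot
    · right
      obtain ⟨μ₀, hμ₀N, hμ₀⟩ := (Submodule.ne_bot_iff N).1 hbot
      let orb : K →ₗ[ℚ] Module.Dual ℚ (U.Coh (U.cmAV K Ψ) 1) :=
        { toFun := fun e => μ₀ ∘ₗ ((U.cmAct K Ψ).ι e : Module.End ℚ _)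
          map_add' := by intro e e'; simp only [map_add, LinearMap.comp_add]
          map_smul' := by intro r e; simp only [map_smul, LinearMap.comp_smul, RingHom.id_apply] }
      have horb_inj : Function.Injective orb := by
        rw [← LinearMap.ker_eq_bot, Submodule.eq_bot_iff]
        intro e he
        have he' : μ₀ ∘ₗ ((U.cmAct K Ψ).ι e : Module.End ℚ _) = 0 := LinearMap.mem_ker.1 he
        by_contra hne
        apply hμ₀
        have hcomp : μ₀ = (μ₀ ∘ₗ ((U.cmAct K Ψ).ι e : Module.End ℚ _)) ∘ₗ
            ((U.cmAct K Ψ).ι e⁻¹ : Module.End ℚ _) := by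
          rw [LinearMap.comp_assoc, ← Module.End.mul_eq_comp, ← map_mul, mul_inv_cancel₀ hne, map_one,
            Module.End.one_eq_id, LinearMap.comp_id]
        rw [hcomp, he', LinearMap.zero_comp]
      have hrange : LinearMap.range orb ≤ N := by
        rintro _ ⟨e, rfl⟩
        exact hstab μ₀ hμ₀N e
      apply Submodule.eq_top_of_finrank_eq
      apply le_antisymm (Submodule.finrank_le N)
      calc Module.finrank ℚ (Module.Dual ℚ (U.Coh (U.cmAV K Ψ) 1)) = Module.finrank ℚ K := hdual
        _ = Module.finrank ℚ (LinearMap.range orb) := (LinearMap.finrank_range_of_inj horb_inj).symm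
        _ ≤ Module.finrank ℚ N := Submodule.finrank_mono hrange
  rcases hN with hbot | htop
  · -- every functional `μ' ∘ F^*` lies in `N = ⊥`, so `F^* = 0`
    ext v
    rw [LinearMap.zero_apply]
    refine (Module.forall_dual_apply_eq_zero_iff ℚ _).1 fun μ' => ?_
    have hmem : μ' ∘ₗ U.pull F 1 ∈ N := by
      rw [hmemN, LinearMap.baseChange_comp, LinearMap.comp_apply]
      have hF' : ((U.pull F 1).baseChange ℂ) α = 0 := hF
      rw [hF', map_zero]
    rw [hbot, Submodule.mem_bot] at hmem
    simpa using LinearMap.congr_fun hmem v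
  · -- `N = ⊤` forces `α = 0`
    exact absurd (eq_zero_of_forall_dual_baseChange α fun μ => (hmemN μ).1 (htop ▸ Submodule.mem_top)) hα0

/-- A CM eigenline is a line, so it has a non-zero vector (`Fact_eigenLine`). -/
theorem exists_mem_eigenLine_ne_zero (heig : U.Fact_eigenLine) (K : CMField) (Ψ : CMType K) (σ : K →+* ℂ) :
    ∃ α ∈ U.eigenLine K Ψ σ, α ≠ 0 := by
  have hne : U.eigenLine K Ψ σ ≠ ⊥ := by
    intro h
    have h1 := heig K Ψ σ
    rw [h] at h1
    simp at h1
  exact (Submodule.ne_bot_iff _).1 hne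

/-- If every morphism `P_Γ → A_{(K,Ψ)}` is zero on `H¹`, then `U_Ψ(Γ) = 0` (generators are pull-backs). -/
theorem Uiso_eq_bot_of_forall_pull_eq_zero {L : CMField} {ι₁ : L →+* ℂ} {V : HermSpace3 L ι₁} (Γ : Level V)
    (K : CMField) (Ψ : CMType K) (σ : K →+* ℂ)
    (h : ∀ F : U.Mor (U.pms L ι₁ V Γ) (U.cmAV K Ψ), U.pull F 1 = 0) : U.Uiso Γ K Ψ σ = ⊥ := by
  rw [eq_bot_iff, Universe.Uiso, Submodule.span_le]
  rintro x ⟨F, α, -, rfl⟩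
  simp [Universe.pullC, h F]

/-- **Kernel, outright**: a non-zero class of `U_Ψ(Γ)` forces a morphism `P_Γ → A_{(K,Ψ)}` non-zero on `H¹`. -/
theorem exists_mor_pull_ne_zero_of_mem_Uiso {L : CMField} {ι₁ : L →+* ℂ} {V : HermSpace3 L ι₁} {Γ : Level V}
    {K : CMField} {Ψ : CMType K} {σ : K →+* ℂ} {ω : U.CohC (U.pms L ι₁ V Γ) 1}
    (hω : ω ∈ U.Uiso Γ K Ψ σ) (hne : ω ≠ 0) :
    ∃ F : U.Mor (U.pms L ι₁ V Γ) (U.cmAV K Ψ), U.pull F 1 ≠ 0 := by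
  by_contra hcon
  simp only [not_exists, ne_eq, not_not] at hcon
  apply hne
  have hbot := Uiso_eq_bot_of_forall_pull_eq_zero Γ K Ψ σ hcon
  rw [hbot] at hω
  exact (Submodule.mem_bot ℂ).1 hω

/-- **B01-S ⟹ FaceAlbaneseReach** (kernel, no facts). -/
theorem albaneseReach_of_faceSupply (h : U.FaceSupply) : U.FaceAlbaneseReach := by
  intro F hG h6 f ι₁ hι V
  obtain ⟨Γ, ω₀, ω₁, h₀, h₁, hne₀, hne₁⟩ := h F hG h6 f ι₁ hι V
  obtain ⟨F₀, hF₀⟩ := exists_mor_pull_ne_zero_of_mem_Uiso h₀ hne₀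
  obtain ⟨F₁, hF₁⟩ := exists_mor_pull_ne_zero_of_mem_Uiso h₁ hne₁
  exact ⟨Γ, F₀, F₁, hF₀, hF₁⟩

/-- **FaceAlbaneseReach ⟹ B01-S** (kernel; uses only the rows `Fact_H1_rank`, `Fact_eigenLine`, `Fact_alphaLine`,
all tree theorems on the model universe).  The witnesses are `F₀^*α₀`, `F₁^*α₁` with `αᵢ` ANY
non-zero `ι₁`-eigen one-form of `A_{(F,Ψᵢ)}` (holomorphic because `ι₁ ∈ Ψᵢ`, `admissible_mem_psi`): isotypicity
(`∈ U_Ψ`) holds by definition of the span, non-vanishing by `eigenSupport_of_H1_rank`. -/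
theorem faceSupply_of_albaneseReach (hH : U.Fact_H1_rank) (heig : U.Fact_eigenLine) (hal : U.Fact_alphaLine)
    (h : U.FaceAlbaneseReach) : U.FaceSupply := by
  have hE := eigenSupport_of_H1_rank hH
  intro F hG h6 f ι₁ hι V
  obtain ⟨Γ, F₀, F₁, hF₀, hF₁⟩ := h F hG h6 f ι₁ hι V
  obtain ⟨α₀, hα₀, hα₀0⟩ := exists_mem_eigenLine_ne_zero heig F (f.psi 0) ι₁
  obtain ⟨α₁, hα₁, hα₁0⟩ := exists_mem_eigenLine_ne_zero heig F (f.psi 1) ι₁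
  have ha₀ : α₀ ∈ U.alphaLine F (f.psi 0) ι₁ := by
    rw [(hal F (f.psi 0) ι₁).1 (admissible_mem_psi f ι₁ hι 0)]; exact hα₀
  have ha₁ : α₁ ∈ U.alphaLine F (f.psi 1) ι₁ := by
    rw [(hal F (f.psi 1) ι₁).1 (admissible_mem_psi f ι₁ hι 1)]; exact hα₁
  exact ⟨Γ, U.pullC F₀ 1 α₀, U.pullC F₁ 1 α₁,
    Submodule.subset_span ⟨F₀, α₀, ha₀, rfl⟩, Submodule.subset_span ⟨F₁, α₁, ha₁, rfl⟩,
    fun h0 => hF₀ (hE F (f.psi 0) ι₁ α₀ hα₀ hα₀0 _ F₀ h0),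
    fun h1 => hF₁ (hE F (f.psi 1) ι₁ α₁ hα₁ hα₁0 _ F₁ h1)⟩

/-- **B01-S ⟺ FaceAlbaneseReach** under the three rows (all tree theorems on the model universe). -/
theorem faceSupply_iff_albaneseReach (hH : U.Fact_H1_rank) (heig : U.Fact_eigenLine) (hal : U.Fact_alphaLine) :
    U.FaceSupply ↔ U.FaceAlbaneseReach :=
  ⟨albaneseReach_of_faceSupply, faceSupply_of_albaneseReach hH heig hal⟩

/-- **Dictionary row (D0)**: for `σ ∈ Ψ`, `U_Ψ(Γ)_σ ≠ 0` iff some morphism `P_Γ → A_{(K,Ψ)}` is non-zero on `H¹(−, ℚ)`. -/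
theorem Uiso_ne_bot_iff (hH : U.Fact_H1_rank) (heig : U.Fact_eigenLine) (hal : U.Fact_alphaLine)
    {L : CMField} {ι₁ : L →+* ℂ} {V : HermSpace3 L ι₁} (Γ : Level V) (K : CMField) (Ψ : CMType K)
    {σ : K →+* ℂ} (hσ : σ ∈ Ψ.1) :
    U.Uiso Γ K Ψ σ ≠ ⊥ ↔ ∃ F : U.Mor (U.pms L ι₁ V Γ) (U.cmAV K Ψ), U.pull F 1 ≠ 0 := by
  constructor
  · intro h
    obtain ⟨ω, hω, hne⟩ := (Submodule.ne_bot_iff _).1 h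
    exact exists_mor_pull_ne_zero_of_mem_Uiso hω hne
  · rintro ⟨F, hF⟩
    obtain ⟨α, hα, hα0⟩ := exists_mem_eigenLine_ne_zero heig K Ψ σ
    have ha : α ∈ U.alphaLine K Ψ σ := by rw [(hal K Ψ σ).1 hσ]; exact hα
    exact (Submodule.ne_bot_iff _).2 ⟨U.pullC F 1 α, Submodule.subset_span ⟨F, α, ha, rfl⟩,
      fun h0 => hF (eigenSupport_of_H1_rank hH K Ψ σ α hα hα0 _ F h0)⟩


end Universe

/-! ## §4  The binder B01 BY NAME from the re-typed supply row -/

namespace Model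

open Literature.NumberTheory.Automorphic
open Literature.NumberTheory.Automorphic.PicardCM
open Literature.AlgebraicGeometry.HodgeTheory

/-- **B01 BY NAME from `FaceAlbaneseReach`, `HeckeWedge10`, `FaceWedgeOverlap`** (three displayed rows, as
before; the supply row re-typed at the level of morphisms) — through the split of record
`perLFace_of_PerL_of_supply_heckeWedge10_overlap`; `Fact_H1_rank`/`Fact_eigenLine`/`Fact_alphaLine` are the tree
theorems `picardCMUniverse_modelAxioms … |>.H1_rank / .eigenLine / .alphaLine`.  `U.PerL` idle. [folklore] -/
theorem perLFace_of_PerL_of_albaneseReach_heckeWedge10_overlap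
    (hA : ∀ (hHD : exists_isReal_hodgeModel) (hI : hodgePQ_independent_of_hodgeModel)
      (h₁ : BallQuotientUniformised) (h₃ : CMAbelianVarietyRealised), (picardCMUniverse hHD hI h₁ h₃).FaceAlbaneseReach)
    (hW : ∀ (hHD : exists_isReal_hodgeModel) (hI : hodgePQ_independent_of_hodgeModel)
      (h₁ : BallQuotientUniformised) (h₃ : CMAbelianVarietyRealised), (picardCMUniverse hHD hI h₁ h₃).HeckeWedge10)
    (hO : ∀ (hHD : exists_isReal_hodgeModel) (hI : hodgePQ_independent_of_hodgeModel)
      (h₁ : BallQuotientUniformised) (h₃ : CMAbelianVarietyRealised), (picardCMUniverse hHD hI h₁ h₃).FaceWedgeOverlap) :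
    PerLFace_of_PerL :=
  perLFace_of_PerL_of_supply_heckeWedge10_overlap
    (fun hHD hI h₁ h₃ => Universe.faceSupply_of_albaneseReach (picardCMUniverse_modelAxioms hHD hI h₁ h₃).H1_rank
      (picardCMUniverse_modelAxioms hHD hI h₁ h₃).eigenLine (picardCMUniverse_modelAxioms hHD hI h₁ h₃).alphaLine
      (hA hHD hI h₁ h₃))
    hW hO

/-- On the model universe of record the re-typing loses nothing: `FaceSupply ↔ FaceAlbaneseReach`. [folklore] -/
theorem picardCMUniverse_faceSupply_iff_albaneseReach (hHD : exists_isReal_hodgeModel)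
    (hI : hodgePQ_independent_of_hodgeModel) (h₁ : BallQuotientUniformised) (h₃ : CMAbelianVarietyRealised) :
    (picardCMUniverse hHD hI h₁ h₃).FaceSupply ↔ (picardCMUniverse hHD hI h₁ h₃).FaceAlbaneseReach :=
  Universe.faceSupply_iff_albaneseReach (picardCMUniverse_modelAxioms hHD hI h₁ h₃).H1_rank
    (picardCMUniverse_modelAxioms hHD hI h₁ h₃).eigenLine (picardCMUniverse_modelAxioms hHD hI h₁ h₃).alphaLine

end Model

end Summit.HodgeConjecture.CorCM

end
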